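import Mathlib
import Literature.Computability.AlgebraicComplexity.ElusiveSymbolic
import Literature.Computability.AlgebraicComplexity.RazElusiveGeneralDischarge
import Literature.Computability.AlgebraicComplexity.ValiantConjectureEquivProofs
import Summits.ValiantsHypothesis.ValiantsHypothesis.Statement
import HarnessLib

/-!
# A univariate reduction of `VP ≠ VNP` (solo seat `solo-ValiantsHypothesis-informed`, s4)

Kernel form of the "quadratic span" reduction of the soloist's note `paper/quadspan.md`, §2 / §2.5.
* `SoloQuadSpanBound K h` — HYPOTHESIS-CARRYING structure: a bound function `Q` with the
  univariate statement "every `(K, h)`-free exponent set `E ⊂ ℕ` (no nontrivial integer relation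
  with `≤ K` terms and coefficients `|c| ≤ h`) such that each `z^e`, `e ∈ E`, lies in the quadratic
  span of `s` algebraic functions `b_j ∈ Ω` (`Ω` an algebraic closure of `Frac ℂ[z]`) has
  `|E| ≤ Q s`".  Conjecture Q* of the note says one exists with `Q s ≤ C s^γ`, `γ < 3/2`;
  NOTHING HERE CONSTRUCTS ONE and nothing is credited toward the summit.
* `SoloDesign K h m n` — a set family `S : Fin m → Finset (Fin n)` bundled with
  `(K, h)`-sign-independence; `SoloDesign.ofPrivatePoints` builds one from private points
  (Reed–Solomon graph families have them); `soloDesignMap S` — the monomial map `(∏_{r∈S i} x_r)_i`.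
* `soloInformed_isElusive_designMap` — THE REDUCTION: `K ≥ 2`, `h ≥ 1`, `B.Q s < m` ⟹ the design
  map is `(s, 2)`-elusive (Raz 2010, Def. 1.1).  Proof: restrict to the curve `x_r = z^{D^r}`,
  `D = hK+1`; the coordinates become `z^{e_i}` with `{e_i}` `(K, h)`-free of size `m` (base-`D`
  signed digits); a degree-2 cover gives, by the symbolic form of non-elusiveness (GMOW 2019,
  Lemma 9.3; tree `exists_aeval_eq_X_pow_of_not_isElusive`), algebraic `b` with every `z^{e_i}` in
  its quadratic span, contradicting the bound.
* `soloInformed_vp_ne_vnp_of_quadSpanBound` (via `Raz2010_result_1_holds`) and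
  `soloInformed_vp_ne_vnp_of_quadSpanBound_cor58` (via `Raz2010_cor_5_8_holds`, `r = r(n)` free —
  the form needing only SOME `γ < 3/2`): designs of the stated sizes, Raz's side conditions,
  `B.Q (s n) < m n` eventually, and poly(`n`)-definability of the design map (Raz Def. 1.3, kept as
  the hypothesis `hdef`) give `VP ℂ ≠ VNP ℂ` (definitionally the summit `ValiantsHypothesis`).

References: R. Raz, Theory of Computing 6 (2010) 135–177, §1 result 1, Cor. 1.14 = Cor. 5.8,
Defs. 1.1, 1.3; A. Garg, V. Makam, R. Oliveira, A. Wigderson, FOCS 2019 (arXiv:1904.04299),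
Lemma 9.3.
-/


noncomputable section

open MvPolynomial Finset

namespace Summit.ValiantsHypothesis.ValiantsHypothesis.Theorems

open Literature.Computability.AlgebraicComplexity

/-- The field of algebraic functions of one complex variable used by the symbolic lemma:
an algebraic closure of `Frac ℂ[z]`. -/
abbrev SoloΩ : Type := AlgebraicClosure (FractionRing (MvPolynomial (Fin 1) ℂ))

/-- The variable `z` as an element of `SoloΩ`. -/
def soloZ : SoloΩ := algebraMap (MvPolynomial (Fin 1) ℂ) SoloΩ (X 0)

/-- **A bound function for the univariate problem, bundled with its defining property** (this is a
HYPOTHESIS wherever it occurs; Conjecture Q* of the note asserts one exists with `Q s = O(s^γ)`,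
`γ < 3/2`).  `bound`: if `E ⊂ ℕ` is `(K, h)`-free — every integer relation `∑_{e ∈ E} c_e · e = 0`
with at most `K` nonzero coefficients on `E`, all of absolute value `≤ h`, is trivial on `E`
(`K = 2k`, `h = 2` is "`B_k^{(2)}`-free"; `K = 4`, `h = 1` contains Sidon) — and every `z^e`,
`e ∈ E`, equals `Γ_e(b)` for some `Γ_e` of total degree `≤ 2` in `s` algebraic functions
`b₁, …, b_s`, then `|E| ≤ Q s`. -/
structure SoloQuadSpanBound (K h : ℕ) where
  /-- the bound, as a function of the number `s` of algebraic functions -/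
  Q : ℕ → ℕ
  /-- `(K, h)`-free exponent sets realised inside a quadratic span of `s` algebraic functions have
  at most `Q s` elements -/
  bound : ∀ (s : ℕ) (b : Fin s → SoloΩ) (E : Finset ℕ),
    (∀ c : ℕ → ℤ, (E.filter fun e => c e ≠ 0).card ≤ K → (∀ e, |c e| ≤ h) →
        (∑ e ∈ E, c e * (e : ℤ)) = 0 → ∀ e ∈ E, c e = 0) →
      (∀ e ∈ E, ∃ Γ : MvPolynomial (Fin s) ℂ, Γ.totalDegree ≤ 2 ∧ aeval b Γ = soloZ ^ e) →
        E.card ≤ Q s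

/-- **A `(K, h)`-sign-independent set family** `S : Fin m → Finset (Fin n)`, bundled with the
property: no integer relation `∑ᵢ cᵢ 1_{Sᵢ} = 0` (coordinatewise) with at most `K` nonzero `cᵢ`,
all of absolute value `≤ h`. -/
structure SoloDesign (K h m n : ℕ) where
  /-- the family -/
  S : Fin m → Finset (Fin n)
  /-- sign-independence to order `K` and height `h` -/
  indep : ∀ c : Fin m → ℤ, (univ.filter fun i => c i ≠ 0).card ≤ K → (∀ i, |c i| ≤ h) →
    (∀ r : Fin n, (∑ i, if r ∈ S i then c i else 0) = 0) → ∀ i, c i = 0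

/-- The monomial map of a set family: `f_i = ∏_{r ∈ S i} x_r`. -/
def soloDesignMap {m n : ℕ} (S : Fin m → Finset (Fin n)) : Fin m → MvPolynomial (Fin n) ℂ :=
  fun i => ∏ r ∈ S i, X r

/-- The base `D = hK + 1` of the curve `x_r = z^{D^r}`. -/
def soloBase (K h : ℕ) : ℕ := h * K + 1

/-- The exponent of `f_i` on the curve: `e_i = ∑_{r ∈ S i} D^r`. -/
def soloExp (K h : ℕ) {m n : ℕ} (S : Fin m → Finset (Fin n)) (i : Fin m) : ℕ :=
  ∑ r ∈ S i, soloBase K h ^ (r : ℕ)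

/-- **Private points give sign-independence** (for every height `h`): if in every subfamily of at
most `K` members each member owns a point missed by the other members, the family is a
`(K, h)`-design.  (Graphs of polynomials of degree `< k'` over `𝔽_q` with `q > (K-1)(k'-1)` have
private points: two of them share `≤ k' - 1` points.) -/
def SoloDesign.ofPrivatePoints {K h m n : ℕ} (S : Fin m → Finset (Fin n))
    (hS : ∀ T : Finset (Fin m), T.card ≤ K → ∀ i ∈ T, ∃ x ∈ S i, ∀ j ∈ T, j ≠ i → x ∉ S j) :
    SoloDesign K h m n where
  S := S
  indep := by
    classical
    intro c hc _ hsum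
    by_contra hne
    push Not at hne
    obtain ⟨i, hi⟩ := hne
    have hiT : i ∈ univ.filter fun i => c i ≠ 0 := by simpa using hi
    obtain ⟨x, hx, hpriv⟩ := hS _ hc i hiT
    have hx' : (∑ j, if x ∈ S j then c j else 0) = c i := by
      rw [Finset.sum_eq_single i]
      · simp [hx]
      · intro j _ hji
        by_cases hcj : c j = 0
        · simp [hcj]
        · have hjT : j ∈ univ.filter fun i => c i ≠ 0 := by simpa using hcj
          simp [hpriv j hjT hji]
      · simp
    exact hi (hx' ▸ hsum x)

/-- Signed digits: if `∑_{r<N} d_r D^r = 0` with all `|d_r| < D` then all `d_r = 0` (`r < N`). -/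
theorem solo_digits_eq_zero (D : ℕ) :
    ∀ (N : ℕ) (d : ℕ → ℤ), (∀ r, |d r| < D) →
      (∑ r ∈ range N, d r * (D : ℤ) ^ r) = 0 → ∀ r < N, d r = 0 := by
  intro N
  induction N with
  | zero => intro d _ _ r hr; omega
  | succ N ih =>
    intro d hd hsum r hr
    have hD : (0 : ℤ) < D := lt_of_le_of_lt (abs_nonneg (d 0)) (hd 0)
    rw [Finset.sum_range_succ'] at hsum
    simp only [pow_zero, mul_one, pow_succ] at hsum
    have hrew : (∑ x ∈ range N, d (x + 1) * ((D : ℤ) ^ x * D)) =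
        (D : ℤ) * ∑ x ∈ range N, d (x + 1) * (D : ℤ) ^ x := by
      rw [Finset.mul_sum]
      exact Finset.sum_congr rfl fun x _ => by ring
    rw [hrew] at hsum
    have h0 : d 0 = 0 := by
      have hdvd : (D : ℤ) ∣ d 0 := ⟨-(∑ x ∈ range N, d (x + 1) * (D : ℤ) ^ x), by linarith⟩
      exact Int.eq_zero_of_abs_lt_dvd hdvd (hd 0)
    have hrest : (∑ x ∈ range N, d (x + 1) * (D : ℤ) ^ x) = 0 := by
      rw [h0, add_zero] at hsum
      rcases mul_eq_zero.1 hsum with h | h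
      · exact absurd h (ne_of_gt hD)
      · exact h
    rcases Nat.eq_zero_or_pos r with rfl | hrpos
    · exact h0
    · have := ih (fun x => d (x + 1)) (fun x => hd (x + 1)) hrest (r - 1) (by omega)
      simpa [Nat.sub_add_cancel hrpos] using this

section Digits

variable {K h m n : ℕ} (S : Fin m → Finset (Fin n))

/-- The digit of `∑ᵢ cᵢ e_i` at position `r`: `∑ᵢ [r ∈ Sᵢ] cᵢ`. -/
def soloDigit (c : Fin m → ℤ) (r : Fin n) : ℤ :=
  ∑ i, (if r ∈ S i then c i else 0)

/-- `∑ᵢ cᵢ e_i = ∑_r digit_r · D^r`. -/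
theorem solo_sum_mul_exp_eq (c : Fin m → ℤ) :
    (∑ i, c i * (soloExp K h S i : ℤ)) =
      ∑ r : Fin n, soloDigit S c r * (soloBase K h : ℤ) ^ (r : ℕ) := by
  classical
  have h1 : ∀ i, c i * (soloExp K h S i : ℤ) =
      ∑ r : Fin n, (if r ∈ S i then c i else 0) * (soloBase K h : ℤ) ^ (r : ℕ) := by
    intro i
    have h2 : ∀ r : Fin n, (if r ∈ S i then c i else 0) * (soloBase K h : ℤ) ^ (r : ℕ)
        = if r ∈ S i then c i * (soloBase K h : ℤ) ^ (r : ℕ) else 0 := fun r => by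
      split_ifs <;> simp
    simp_rw [h2, Finset.sum_ite_mem, Finset.univ_inter, soloExp, Nat.cast_sum, Nat.cast_pow,
      Finset.mul_sum]
  simp_rw [h1]
  rw [Finset.sum_comm]
  refine Finset.sum_congr rfl fun r _ => ?_
  rw [soloDigit, Finset.sum_mul]

/-- Digits are small: `|digit_r| ≤ h · #supp c`. -/
theorem solo_abs_digit_le (c : Fin m → ℤ) (hc2 : ∀ i, |c i| ≤ h) (r : Fin n) :
    |soloDigit S c r| ≤ h * ((univ.filter fun i => c i ≠ 0).card : ℤ) := by
  classical
  unfold soloDigit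
  calc |∑ i, (if r ∈ S i then c i else 0)|
      ≤ ∑ i, |(if r ∈ S i then c i else 0)| := Finset.abs_sum_le_sum_abs _ _
    _ ≤ ∑ i, (if c i ≠ 0 then (h : ℤ) else 0) := by
        refine Finset.sum_le_sum fun i _ => ?_
        by_cases h0 : c i = 0
        · simp [h0]
        · rw [if_pos h0]
          split_ifs
          · exact hc2 i
          · simp
    _ = h * ((univ.filter fun i => c i ≠ 0).card : ℤ) := by
        rw [Finset.sum_ite, Finset.sum_const_zero, add_zero, Finset.sum_const, nsmul_eq_mul,
          mul_comm]

end Digits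

section Design

variable {K h m n : ℕ} (S : SoloDesign K h m n)

/-- **Relation transfer.** A short small-coefficient relation among the exponents `e_i` is a
relation among the indicator vectors `1_{S i}` (base-`D` digits), hence trivial for a design. -/
theorem solo_rel_of_exp_rel (c : Fin m → ℤ)
    (hc : (univ.filter fun i => c i ≠ 0).card ≤ K) (hc2 : ∀ i, |c i| ≤ h)
    (hrel : (∑ i, c i * (soloExp K h S.S i : ℤ)) = 0) : ∀ i, c i = 0 := by
  classical
  refine S.indep c hc hc2 fun r => ?_
  let d : ℕ → ℤ := fun t => if ht : t < n then soloDigit S.S c ⟨t, ht⟩ else 0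
  have hd : ∀ r : Fin n, d r = soloDigit S.S c r := fun r => by simp [d, r.isLt]
  have hsum : (∑ t ∈ range n, d t * (soloBase K h : ℤ) ^ t) = 0 := by
    rw [← Fin.sum_univ_eq_sum_range (fun t => d t * (soloBase K h : ℤ) ^ t) n, ← hrel,
      solo_sum_mul_exp_eq]
    exact Finset.sum_congr rfl fun r _ => by rw [hd]
  have hbound : ∀ t, |d t| < (soloBase K h : ℤ) := by
    intro t
    by_cases ht : t < n
    · have h1 := solo_abs_digit_le S.S c hc2 ⟨t, ht⟩
      have h2 : ((univ.filter fun i => c i ≠ 0).card : ℤ) ≤ K := by exact_mod_cast hc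
      have h3 : d t = soloDigit S.S c ⟨t, ht⟩ := by simp [d, ht]
      have h4 : (h : ℤ) * ((univ.filter fun i => c i ≠ 0).card : ℤ) ≤ h * K :=
        mul_le_mul_of_nonneg_left h2 (by positivity)
      rw [h3]
      simp only [soloBase]
      push_cast
      linarith
    · have h3 : d t = 0 := by simp [d, ht]
      rw [h3, abs_zero]
      simp only [soloBase]
      positivity
  have := solo_digits_eq_zero (soloBase K h) n d hbound hsum r r.isLt
  rwa [hd] at this

/-- The exponents `e_i` of a design are pairwise distinct (`K ≥ 2`, `h ≥ 1`). -/
theorem solo_exp_injective (hK : 2 ≤ K) (hh : 1 ≤ h) :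
    Function.Injective (soloExp K h S.S) := by
  classical
  intro i j hij
  by_contra hne
  let c : Fin m → ℤ := fun l => (if l = i then 1 else 0) - (if l = j then 1 else 0)
  have hci : c i = 1 := by simp [c, hne]
  have hsupp : (univ.filter fun l => c l ≠ 0) ⊆ {i, j} := by
    intro l hl
    simp only [Finset.mem_filter, Finset.mem_univ, true_and] at hl
    simp only [Finset.mem_insert, Finset.mem_singleton]
    by_contra hl'
    push Not at hl'
    exact hl (by simp [c, hl'.1, hl'.2])
  have hcard : (univ.filter fun l => c l ≠ 0).card ≤ K :=
    (Finset.card_le_card hsupp).trans ((Finset.card_insert_le _ _).trans (by simp; omega))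
  have hc2 : ∀ l, |c l| ≤ h := by
    intro l
    have hh' : (1 : ℤ) ≤ h := by exact_mod_cast hh
    simp only [c]
    split_ifs <;> simp <;> linarith
  have hsum : (∑ l, c l * (soloExp K h S.S l : ℤ)) = 0 := by
    simp only [c, sub_mul, Finset.sum_sub_distrib, ite_mul, one_mul, zero_mul,
      Finset.sum_ite_eq', Finset.mem_univ, if_true]
    rw [hij, sub_self]
  have := solo_rel_of_exp_rel S c hcard hc2 hsum i
  rw [hci] at this
  exact one_ne_zero this

/-- The exponent set of a design is `(K, h)`-free. -/
theorem solo_free_image (hK : 2 ≤ K) (hh : 1 ≤ h) (c : ℕ → ℤ)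
    (hc : ((univ.image (soloExp K h S.S)).filter fun e => c e ≠ 0).card ≤ K)
    (hc2 : ∀ e, |c e| ≤ h)
    (hsum : (∑ e ∈ univ.image (soloExp K h S.S), c e * (e : ℤ)) = 0) :
    ∀ e ∈ univ.image (soloExp K h S.S), c e = 0 := by
  classical
  intro e he
  have hinj := solo_exp_injective S hK hh
  have h1 : (∑ i, c (soloExp K h S.S i) * (soloExp K h S.S i : ℤ)) = 0 := by
    rwa [Finset.sum_image (fun x _ y _ hxy => hinj hxy)] at hsum
  have h2 : (univ.filter fun i => c (soloExp K h S.S i) ≠ 0).card ≤ K := by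
    refine le_trans ?_ hc
    rw [← Finset.card_image_of_injective (univ.filter fun i => c (soloExp K h S.S i) ≠ 0) hinj]
    refine Finset.card_le_card ?_
    intro e he
    simp only [Finset.mem_image, Finset.mem_filter, Finset.mem_univ, true_and] at he ⊢
    obtain ⟨i, hi, rfl⟩ := he
    exact ⟨⟨i, rfl⟩, hi⟩
  obtain ⟨i, -, rfl⟩ := Finset.mem_image.1 he
  exact solo_rel_of_exp_rel S (fun i => c (soloExp K h S.S i)) h2 (fun i => hc2 _) h1 i

end Design

section Curve

variable {K h m n : ℕ} (S : Fin m → Finset (Fin n))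

/-- On the curve `x_r = y^{D^r}` the `i`-th design monomial is `y^{e_i}`. -/
theorem solo_eval_designMap_curve (y : Fin 1 → ℂ) (i : Fin m) :
    eval (fun r : Fin n => (y 0) ^ (soloBase K h ^ (r : ℕ))) (soloDesignMap S i)
      = eval y ((X 0 : MvPolynomial (Fin 1) ℂ) ^ soloExp K h S i) := by
  simp only [soloDesignMap, soloExp, map_prod, map_pow, eval_X, Finset.prod_pow_eq_pow_sum]

/-- The image of the curve lies in the image of the design map. -/
theorem solo_range_pow_subset :
    Set.range (polyMapEval fun i => (X 0 : MvPolynomial (Fin 1) ℂ) ^ soloExp K h S i)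
      ⊆ Set.range (polyMapEval (soloDesignMap S)) := by
  rintro _ ⟨y, rfl⟩
  refine ⟨fun r : Fin n => (y 0) ^ (soloBase K h ^ (r : ℕ)), ?_⟩
  funext i
  simp only [polyMapEval_apply]
  exact solo_eval_designMap_curve S y i

/-- Coordinates of a design map have total degree `≤ n`. -/
theorem solo_totalDegree_designMap_le (i : Fin m) : (soloDesignMap S i).totalDegree ≤ n := by
  classical
  calc (soloDesignMap S i).totalDegree
      ≤ ∑ r ∈ S i, (X r : MvPolynomial (Fin n) ℂ).totalDegree := totalDegree_finsetProd _ _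
    _ ≤ ∑ r ∈ S i, 1 := Finset.sum_le_sum fun r _ => (totalDegree_X (R := ℂ) r).le
    _ = (S i).card := by simp
    _ ≤ n := by simpa using Finset.card_le_univ (S i)

end Curve

/-- **Quad-span bound ⇒ elusive design maps.** For a `(K, h)`-design `S` of `m` sets (`K ≥ 2`,
`h ≥ 1`) and a univariate bound structure `B` with `B.Q s < m`, the monomial map of `S` is
`(s, 2)`-elusive over `ℂ` (Raz 2010, Def. 1.1). [cite: Raz2010, Def. 1.1; GMOW2019, Lemma 9.3] -/
theorem soloInformed_isElusive_designMap {K h m n : ℕ} (hK : 2 ≤ K) (hh : 1 ≤ h)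
    (S : SoloDesign K h m n) (B : SoloQuadSpanBound K h) {s : ℕ} (hm : B.Q s < m) :
    IsElusive (soloDesignMap S.S) s 2 := by
  classical
  by_contra hne
  have hg : ¬ IsElusive (fun i => (X 0 : MvPolynomial (Fin 1) ℂ) ^ soloExp K h S.S i) s 2 := by
    intro hg
    apply hne
    intro Γ hΓ hsub
    exact hg Γ hΓ ((solo_range_pow_subset S.S).trans hsub)
  obtain ⟨Γ, b, hΓ, hb⟩ := exists_aeval_eq_X_pow_of_not_isElusive (soloExp K h S.S) hg
  have hcard : (univ.image (soloExp K h S.S)).card = m := by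
    rw [Finset.card_image_of_injective _ (solo_exp_injective S hK hh), Finset.card_univ,
      Fintype.card_fin]
  have hspan : ∀ e ∈ univ.image (soloExp K h S.S),
      ∃ Γ' : MvPolynomial (Fin s) ℂ, Γ'.totalDegree ≤ 2 ∧ aeval b Γ' = soloZ ^ e := by
    intro e he
    obtain ⟨i, -, rfl⟩ := Finset.mem_image.1 he
    exact ⟨Γ i, hΓ i, by rw [soloZ]; exact (hb i).symm⟩
  have := B.bound s b _ (solo_free_image S hK hh) hspan
  omega

/-- **Quad-span bound + explicit designs ⇒ `VP ℂ ≠ VNP ℂ`** through Raz 2010, §1 result 1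
(tree theorem `Raz2010_result_1_holds`): `(K, h)`-designs `S n` of `m n = n^{ω(1)}` subsets of
`Fin n`, a parameter `s` with `m n ^ 9 ≤ s n ^ 10` and `B.Q (s n) < m n` eventually, and
poly(`n`)-definability of the design map (Raz Def. 1.3, hypothesis `hdef`) yield Valiant's
hypothesis over `ℂ` from a univariate bound structure `B`. [cite: Raz2010, §1 result 1, Defs. 1.1, 1.3] -/
theorem soloInformed_vp_ne_vnp_of_quadSpanBound {K h : ℕ} (hK : 2 ≤ K) (hh : 1 ≤ h)
    (B : SoloQuadSpanBound K h) {m s : ℕ → ℕ} (S : ∀ n, SoloDesign K h (m n) n)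
    (hm : ∀ c : ℕ, ∃ n₀ : ℕ, ∀ n ≥ n₀, n ^ c ≤ m n)
    (hs : ∃ n₀ : ℕ, ∀ n ≥ n₀, m n ^ 9 ≤ s n ^ 10)
    (hQm : ∃ n₀ : ℕ, ∀ n ≥ n₀, B.Q (s n) < m n)
    (hdef : IsPolyDefinableMap (m := m) (σ := fun n => Fin n) fun n => soloDesignMap (S n).S) :
    VP ℂ ≠ VNP ℂ := by
  refine perNotPComputableComplex_iff_holds.mp ?_
  have hdeg : IsPBounded
      (fun n => Finset.univ.sup fun i : Fin (m n) => (soloDesignMap (S n).S i).totalDegree) :=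
    IsPBounded.id.mono fun n => Finset.sup_le fun i _ => solo_totalDegree_designMap_le (S n).S i
  have hel : ∃ n₀ : ℕ, ∀ n ≥ n₀, IsElusive (soloDesignMap (S n).S) (s n) 2 := by
    obtain ⟨n₀, h0⟩ := hQm
    exact ⟨n₀, fun n hn => soloInformed_isElusive_designMap hK hh (S n) B (h0 n hn)⟩
  exact Raz2010_result_1_holds ℂ ringChar_complex_ne_two m s (fun n => soloDesignMap (S n).S)
    hm hs hdef hdeg hel

/-- **The same reduction through Raz 2010, Cor. 5.8 (= Cor. 1.14), with `r = r(n)` free.**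
This is the form in which the univariate bound is needed only with SOME exponent `γ < 3/2`
(`m = C(n+r-1, r) ≈ n^r`, `s ≈ n^{2r/3 + o(r)}`, note §2.5): `(K, h)`-designs `S n` of exactly
`C(n + r n - 1, r n)` subsets of `Fin n`, Raz's side conditions on `r, s`,
`B.Q (s n) < C(n + r n - 1, r n)` eventually, and poly(`n`)-definability give `VP ℂ ≠ VNP ℂ`
(elusiveness is used over `G = ℂ` itself). [cite: Raz2010, Cor. 5.8 = Cor. 1.14, Defs. 1.1, 1.3] -/
theorem soloInformed_vp_ne_vnp_of_quadSpanBound_cor58 {K h : ℕ} (hK : 2 ≤ K) (hh : 1 ≤ h)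
    (B : SoloQuadSpanBound K h) {r s : ℕ → ℕ}
    (S : ∀ n, SoloDesign K h (Nat.choose (n + r n - 1) (r n)) n)
    (hpar : ∃ n₀ : ℕ, ∀ n ≥ n₀, 3 ≤ r n ∧ r n ≤ n ∧ n ≤ s n)
    (hgrow : ∀ c : ℕ, ∃ n₀ : ℕ, ∀ n ≥ n₀,
      n ^ c * Nat.choose (n + 2 * r n / 3 - 1) (2 * r n / 3) ≤ s n)
    (hQm : ∃ n₀ : ℕ, ∀ n ≥ n₀, B.Q (s n) < Nat.choose (n + r n - 1) (r n))
    (hdef : IsPolyDefinableMap (m := fun n => Nat.choose (n + r n - 1) (r n))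
      (σ := fun n => Fin n) fun n => soloDesignMap (S n).S) :
    VP ℂ ≠ VNP ℂ := by
  refine perNotPComputableComplex_iff_holds.mp ?_
  have hel : ∃ n₀ : ℕ, ∀ n ≥ n₀, ∃ (G : Type) (_ : Field G) (_ : Algebra ℂ G),
      IsElusive (fun i => MvPolynomial.map (algebraMap ℂ G) (soloDesignMap (S n).S i))
        (s n) 2 := by
    obtain ⟨n₀, h0⟩ := hQm
    refine ⟨n₀, fun n hn => ⟨ℂ, inferInstance, inferInstance, ?_⟩⟩
    have hid : (fun i => MvPolynomial.map (algebraMap ℂ ℂ) (soloDesignMap (S n).S i))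
        = soloDesignMap (S n).S := by
      funext i
      rw [Algebra.algebraMap_self, MvPolynomial.map_id]
    rw [hid]
    exact soloInformed_isElusive_designMap hK hh (S n) B (h0 n hn)
  exact Raz2010_cor_5_8_holds ℂ ringChar_complex_ne_two r s (fun n => soloDesignMap (S n).S)
    hpar hgrow hdef hel

end Summit.ValiantsHypothesis.ValiantsHypothesis.Theorems
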